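import Summits.KontsevichZagierPeriods.KontsevichZagierPeriods.Theorems.CobordismMoveEllipsoidGaussMapCoV
import Summits.KontsevichZagierPeriods.KontsevichZagierPeriods.Theorems.CobordismMoveCP2VolumeCharts
import Literature.NumberTheory.Transcendental.KZKernelConjectureForms

/-!
# Line `EllipsoidGaussKronecker` — a RUNG LINE on crux `TopologicalMovesKernel`
(stmt-KontsevichZagierPeriods-5565, route CobordismMove; the route's deciding theorem is
`closes : CubeStokes → SignedSheetTransfer → TopologicalMovesKernel → KontsevichZagierPeriods`)

FORWARD (rung-harvest of seat fwd-rung-KontsevichZagierPeriods-05, G1 next-rung; FORWARD DISCIPLINE F2):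
* generator = rung ; seed = g1-KontsevichZagierPeriods-5569 ;
* floor / witness = `Summit.KontsevichZagierPeriods.CobordismMove.ellipsoidGaussMapCoV_proof`
  (stmt-KontsevichZagierPeriods-5569 `CobordismMove.EllipsoidGaussMapCoV`, PROVED) = `Rung 2` — compiled witness
  `Lines/EllipsoidGaussKronecker_special.lean` (`theorem rung_two : Rung 2`, no sorry: the floor re-curried,
  `simpa [Fin.sum_univ_two, Fin.prod_univ_two, sub_sub]`);
* rung_decl = `Summit.KontsevichZagierPeriods.KontsevichZagierPeriods.Theses.GaussKroneckerLadder.EllipsoidGaussKroneckerCoV`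
  (`:= ∀ n, Rung n`);
* step = dimension: surface (n = 2, Gauss curvature `K = 1/(ABC·M²)`, `Matrix.det_fin_two_of`) → hypersurface of every
  dimension n (Gauss–Kronecker curvature `K = 1/(C·ΠAᵢ·M^{(n+2)/2})`, rank-one determinant lemma); first new case n = 3
  (values `π²`: half of `vol(S³) = 2π²`);
* gap_after = every `Rung n` is ONE explicit move of rule (2) between two representations of `vol(Sⁿ)/2` along a
  semialgebraic diffeomorphism (accessibility, instance by instance). The rung after it — Hopf's theorem
  `∫_M K dV = deg(γ)·vol(Sⁿ) = (χ(M)/2)·vol(Sⁿ)` for a closed `ℚ`-Nash hypersurface `M ⊂ ℝⁿ⁺¹`, `n` even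
  [Hopf, Math. Ann. 95 (1925/26); Burns–Gidea 2005 Rem. 7.7.8 p.228] as a CHAIN of moves — needs the Gauss map where it
  is NOT injective: a signed count of sheets (the parent's crux `SignedSheetTransfer`, stmt-5567: "degree is a move")
  over a semialgebraic cell decomposition off the critical values [Cecil–Ryan 1985 p.16, p.24]; after that the
  Pontryagin/signature sector (`SignatureSector`, stmt-6791, informal) and then the KERNEL theorem itself
  (`TopologicalMovesKernel` = the kernel conjecture on the topological sector ⊇ everything, Grothendieck-period-conjecture
  strength [Huber–Wüstholz 2022 p.11–12]) — ladder_ceiling capped-at-single-global-diffeomorphism-calibrations,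
  disposition frontier.

HOW IT ADVANCES THE CRUX (honesty clause). `TopologicalMovesKernel` is the kernel conjecture for the move group enlarged
by the route's topological moves; it is summit-strength (the route's `closes` feeds it `CubeStokes` and
`SignedSheetTransfer` and concludes the summit by `kzKernelConjecture_iff_isRational`). This line does NOT conclude it.
It is the next THEOREM-GRADE rung of the route's Chern–Weil sector beyond the proved surface floor: for every dimension
`n` and all rational semi-axes it DECIDES the kernel instances `[U, K dV] − [Bⁿ, dA_{Sⁿ₊}]` (value `0`) by exhibiting
them as ONE move — the calibration `K dV_E = γ^*(dA_{Sⁿ})` that the route's degree argument (`SignedSheetTransfer`)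
multiplies by `deg γ`. The witness pins the lower end to the proved floor (F3); `S → Rung` does NOT close formally (the
rung asserts membership in the move SET `changeOfVariablesRel`, finer than `KZ.Equivalent`, and the value identity
`∫_U K dV = vol(Sⁿ)/2` is analytic, not in the tree) — recorded as F4-informational; the [nec]-trap is discharged by the
witness, not by a converse.

THE SKELETON (sorries ONLY in the four stubs; `EllipsoidGaussKroneckerCoV_of : EllipsoidGaussKroneckerCoV` kernel-checked).
Throughout `U = {Σ pᵢ²/aᵢ < 1}`, `M(p) = Σ pᵢ²/aᵢ² + (1 − Σ pᵢ²/aᵢ)/c`, `Φ(p)ᵢ = pᵢ/(aᵢ√M)` (projected Gauss map),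
`J(p)ᵢⱼ = δᵢⱼ/(aᵢ√M) − pᵢ·(pⱼ/aⱼ² − pⱼ/(aⱼc))/(aᵢ M √M)` (its Jacobian), entering through defining hypotheses
`hm`, `hΦ`, `hJ` exactly as in the floor's proof file (no definitions introduced; `n = 2` of each stub is the floor's lemma):
* `stub_semialgebraic` — `Φ` is `ℚ`-semialgebraic on `U` for rational `Aᵢ, C` (coordinatewise: coordinate / (rational
                          constant · √(ℚ-polynomial ≠ 0)); floor: `isSemialgebraicMapOn_gauss`, `Fin.forall_fin_two`). [S/M]
* `stub_hasFDerivAt`   — `Φ` is differentiable on `U` with derivative `toLin' (J p)` (`hasFDerivAt_pi'`, product/chain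
                          rule per coordinate; floor: `hasFDerivAt_gauss`, two coordinates by hand).              [M]
* `stub_bijOn`         — `Φ` is injective on `U` with image EXACTLY the open unit ball (explicit inverse
                          `Ψ(w)ᵢ = aᵢwᵢ/√(Σ aⱼwⱼ² + c(1 − |w|²))`, `M(Ψ w) = 1/Q²`; floor: `injOn_gauss`, `image_gauss`,
                          `fin_cases`).                                                                       [M]
* `stub_integrand`     — THE NEW STEP (where the floor's `Matrix.det_fin_two_of` cofactor expansion stops): the
                          dimension-free Jacobian identity `1/(Πaᵢ · z · √M^{n+1}) = (1/√(1 − |Φ|²))·|det J|`, from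
                          the factorisation `Φ = diag(1/aᵢ) ∘ Ψ`, `Ψ(p) = g(p) • p`, `g = (√M)⁻¹`, so that
                          `DΦ = diag(1/aᵢ) ∘ (g • id + Dg ⊗ p)` and, by the RANK-ONE DETERMINANT LEMMA already landed
                          in this route's Theorems — `CobordismMove.CP2Volume.det_smul_id_add_smulRight`
                          (`det (c • id + f.smulRight x) = cⁿ(1 + c⁻¹ f x)`, file `CobordismMoveCP2VolumeCharts.lean`,
                          used there for the ISOTROPIC Cauchy chart `y/√(1+|y|²)`) — `det DΦ = gⁿ(1 + g⁻¹Dg[p])/Πaᵢ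
                          = gⁿ⁺²/(c·Πaᵢ)` (as `Dg[p] = −g³(M − 1/c)`), the Gauss–Kronecker curvature `K > 0`; with
                          `1 − |Φ|² = z²/(c²M)` this is the identity (`Matrix.det_mul`, `Matrix.det_diagonal`,
                          `LinearMap.det_toLin'`).                                                            [M]
Composition = the floor's final assembly verbatim in dimension `n` → `rung_of` (proved, parametric in the four stub
statements) → `EllipsoidGaussKroneckerCoV_of`. ENGINES IN SCOPE (imported): the floor's six lemmas (`n = 2`
instances of the stubs) and the route's dimension-`n` Cauchy-chart kit `CP2Volume.exists_cauchyChart`,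
`isSemialgebraicMapOn_cauchy`, `injective_cauchy`, `range_cauchy` (same shape `Φ(y)ᵢ = g(y)·yᵢ`, isotropic `g`) —
the stubs are their anisotropic (`diag(1/aᵢ)`, `M` an anisotropic quadratic form) counterparts on a bounded domain.
References: M. Kontsevich, D. Zagier, *Periods* (2001) §1.2 rule (2); H. Hopf, *Über die Curvatura integra
geschlossener Hyperflächen*, Math. Ann. 95 (1925/26) 340–367; K. Burns, M. Gidea, *Differential Geometry and Topology*
(2005) Rem. 7.7.8; J. Bochnak, M. Coste, M.-F. Roy, *Real Algebraic Geometry* (1998) Prop. 2.2.6.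
-/

noncomputable section

-- `Summit.KontsevichZagierPeriods.KontsevichZagierPeriods.…` is the tree's mandated layout (single-conjunct summit).
set_option linter.dupNamespace false

open MeasureTheory Set
open Literature.ModelTheory.ExponentialFields (IsSemialgebraic)

namespace Summit.KontsevichZagierPeriods.KontsevichZagierPeriods.Theses.GaussKroneckerLadder

open Literature.NumberTheory.Transcendental

/-- **The ladder.** `Rung n`: the Gauss map of the `n`-ellipsoid `Σ xᵢ²/Aᵢ + z²/C = 1` (`Aᵢ, C ∈ ℚ_{>0}`) is one move of
rule (2) from the Gauss–Kronecker-curvature density `K dV = dx/(ΠAᵢ · z · M^{(n+1)/2})`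
(`z = √(C(1 − Σ xᵢ²/Aᵢ))`, `M = Σ xᵢ²/Aᵢ² + z²/C²`) on the open ellipsoidal ball `{Σ xᵢ²/Aᵢ < 1}` onto the area
density `1/√(1 − |w|²)` of the upper unit hemisphere on the open unit `n`-ball. `Rung 2` is the floor
`CobordismMove.EllipsoidGaussMapCoV` (stmt-5569, proved). Both values are `vol(Sⁿ)/2`. -/
def Rung (n : ℕ) : Prop :=
  ∀ (A : Fin n → ℚ) (C : ℚ), (∀ i, 0 < A i) → 0 < C →
    ∀ (r r' : KZ.IntegralRep n),
      r.domain = {p | ∑ i, (p i) ^ 2 / (A i : ℝ) < 1} →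
      Set.EqOn r.integrand (fun p => 1 / ((∏ i, (A i : ℝ)) *
          Real.sqrt ((C : ℝ) * (1 - ∑ i, (p i) ^ 2 / (A i : ℝ))) *
          Real.sqrt (∑ i, (p i) ^ 2 / (A i : ℝ) ^ 2 +
            (1 - ∑ i, (p i) ^ 2 / (A i : ℝ)) / (C : ℝ)) ^ (n + 1))) r.domain →
      r'.domain = {w | ∑ i, (w i) ^ 2 < 1} →
      Set.EqOn r'.integrand (fun w => 1 / Real.sqrt (1 - ∑ i, (w i) ^ 2)) r'.domain →
      KZ.of r - KZ.of r' ∈ KZ.changeOfVariablesRel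

/-- **The rung of the line** (crux-level decl): ALL dimensions. `n = 2` is the floor, `n = 3` the first new case; the
skeleton below is uniform in `n`. [cite: KontsevichZagier2001, §1.2] -/
def EllipsoidGaussKroneckerCoV : Prop := ∀ n, Rung n

/-! ## The four stubs (dimension `n`; their `n = 2` instances are the floor's lemmas) -/

/-- `stub_semialgebraic` — **the projected Gauss map is `ℚ`-semialgebraic on the open ellipsoidal ball** for rational
`Aᵢ, C > 0`: each coordinate is a coordinate function divided by the rational constant `Aᵢ` times the square root of the
`ℚ`-polynomial `M`, non-vanishing on `U` (`isSemialgebraicFunOn_aeval`, `.sqrt_holds`, `.mul_holds`, `.div`,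
`IsSemialgebraicMapOn.of_forall`). Floor (`n = 2`): `CobordismMove.isSemialgebraicMapOn_gauss`.
[cite: BochnakCosteRoy1998, Prop. 2.2.6] -/
theorem stub_semialgebraic {n : ℕ} {A : Fin n → ℚ} {C : ℚ} (hA : ∀ i, 0 < A i) (hC : 0 < C)
    {m : (Fin n → ℝ) → ℝ}
    (hm : ∀ p, m p = ∑ i, p i ^ 2 / (A i : ℝ) ^ 2 + (1 - ∑ i, p i ^ 2 / (A i : ℝ)) / (C : ℝ))
    {Φ : (Fin n → ℝ) → Fin n → ℝ} (hΦ : ∀ p i, Φ p i = p i / ((A i : ℝ) * √(m p)))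
    (hU : IsSemialgebraic ℚ {p : Fin n → ℝ | ∑ i, p i ^ 2 / (A i : ℝ) < 1}) :
    IsSemialgebraicMapOn ℚ {p : Fin n → ℝ | ∑ i, p i ^ 2 / (A i : ℝ) < 1} Φ := by
  sorry

/-- `stub_hasFDerivAt` — **the projected Gauss map is differentiable on the open ellipsoidal ball, with derivative its
explicit Jacobian** `Jᵢⱼ = δᵢⱼ/(aᵢ√M) − pᵢ ∂ⱼM/(2 aᵢ M √M)`, `∂ⱼM = 2pⱼ(1/aⱼ² − 1/(aⱼc))` (`hasFDerivAt_pi'`; product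
and chain rules for `pᵢ · aᵢ⁻¹ · (√M)⁻¹`, `M` a quadratic polynomial, `M ≠ 0` on `U`). Floor (`n = 2`):
`CobordismMove.hasFDerivAt_gauss`. [folklore] -/
theorem stub_hasFDerivAt {n : ℕ} {a : Fin n → ℝ} {c : ℝ} (ha : ∀ i, 0 < a i) (hc : 0 < c)
    {m : (Fin n → ℝ) → ℝ}
    (hm : ∀ p, m p = ∑ i, p i ^ 2 / a i ^ 2 + (1 - ∑ i, p i ^ 2 / a i) / c)
    {Φ : (Fin n → ℝ) → Fin n → ℝ} (hΦ : ∀ p i, Φ p i = p i / (a i * √(m p)))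
    {J : (Fin n → ℝ) → Matrix (Fin n) (Fin n) ℝ}
    (hJ : ∀ p i j, J p i j = (if i = j then 1 / (a i * √(m p)) else 0) -
      p i * (p j / a j ^ 2 - p j / (a j * c)) / (a i * m p * √(m p)))
    {p : Fin n → ℝ} (hp : ∑ i, p i ^ 2 / a i < 1) :
    HasFDerivAt Φ (LinearMap.toContinuousLinearMap (Matrix.toLin' (J p))) p := by
  sorry

/-- `stub_bijOn` — **the projected Gauss map is injective on the open ellipsoidal ball and maps it ONTO the open unit
ball**: `Ψ(w)ᵢ = aᵢwᵢ/Q`, `Q = √(Σ aⱼwⱼ² + c(1 − |w|²))`, satisfies `Ψ ∘ Φ = id` on `U` (`Q(Φ p) = 1/√M`), `Ψ(Bⁿ) ⊆ U`,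
`M(Ψ w) = 1/Q²` and `Φ ∘ Ψ = id` on `Bⁿ`; and `1 − |Φ p|² = (1 − Σ pᵢ²/aᵢ)/(cM) > 0`. Floor (`n = 2`):
`CobordismMove.injOn_gauss`, `CobordismMove.image_gauss`. [folklore] -/
theorem stub_bijOn {n : ℕ} {a : Fin n → ℝ} {c : ℝ} (ha : ∀ i, 0 < a i) (hc : 0 < c)
    {m : (Fin n → ℝ) → ℝ}
    (hm : ∀ p, m p = ∑ i, p i ^ 2 / a i ^ 2 + (1 - ∑ i, p i ^ 2 / a i) / c)
    {Φ : (Fin n → ℝ) → Fin n → ℝ} (hΦ : ∀ p i, Φ p i = p i / (a i * √(m p))) :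
    InjOn Φ {p : Fin n → ℝ | ∑ i, p i ^ 2 / a i < 1} ∧
      Φ '' {p : Fin n → ℝ | ∑ i, p i ^ 2 / a i < 1} = {w : Fin n → ℝ | ∑ i, w i ^ 2 < 1} := by
  sorry

/-- `stub_integrand` — **THE NEW STEP: the dimension-free change-of-variables identity `K dV_E = dA_{Sⁿ}`.** With
`q = √M`, `z = √(c(1 − Σ pᵢ²/aᵢ))`: `J = diag(1/(aᵢq))·(1 − u vᵀ)` with `u = p`, `vⱼ = (1/aⱼ² − 1/(aⱼc))pⱼ/M`
(equivalently `toLin' J = diag(1/aᵢ) ∘ (g • id + Dg ⊗ p)`, `g = 1/q`), so by the rank-one determinant lemma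
(`CobordismMove.CP2Volume.det_one_add_smulRight` / `det_smul_id_add_smulRight`, landed; or Mathlib's
`Matrix.det_one_sub_mul_comm`, `Matrix.det_one_add_replicateCol_mul_replicateRow`) and `Matrix.det_diagonal`:
`det J = (1 − v·u)/(Πaᵢ · qⁿ) = 1/(c · Πaᵢ · q^{n+2})` (since `M − Σ(1/aⱼ² − 1/(aⱼc))pⱼ² = 1/c`), which is the
Gauss–Kronecker curvature `K > 0`; and `1 − |Φ|² = z²/(c²M)`; hence
`1/(Πaᵢ · z · q^{n+1}) = (1/√(1 − |Φ|²))·|det J|`. Floor (`n = 2`): `CobordismMove.integrand_gauss`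
(`Matrix.det_fin_two_of`). [folklore] -/
theorem stub_integrand {n : ℕ} {a : Fin n → ℝ} {c : ℝ} (ha : ∀ i, 0 < a i) (hc : 0 < c)
    {m : (Fin n → ℝ) → ℝ}
    (hm : ∀ p, m p = ∑ i, p i ^ 2 / a i ^ 2 + (1 - ∑ i, p i ^ 2 / a i) / c)
    {Φ : (Fin n → ℝ) → Fin n → ℝ} (hΦ : ∀ p i, Φ p i = p i / (a i * √(m p)))
    {J : (Fin n → ℝ) → Matrix (Fin n) (Fin n) ℝ}
    (hJ : ∀ p i j, J p i j = (if i = j then 1 / (a i * √(m p)) else 0) -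
      p i * (p j / a j ^ 2 - p j / (a j * c)) / (a i * m p * √(m p)))
    {p : Fin n → ℝ} (hp : ∑ i, p i ^ 2 / a i < 1) :
    1 / ((∏ i, a i) * √(c * (1 - ∑ i, p i ^ 2 / a i)) *
        √(∑ i, p i ^ 2 / a i ^ 2 + (1 - ∑ i, p i ^ 2 / a i) / c) ^ (n + 1)) =
      1 / √(1 - ∑ i, Φ p i ^ 2) * |(LinearMap.toContinuousLinearMap (Matrix.toLin' (J p))).det| := by
  sorry

/-! ## Composition (sorry-free) -/

/-- **The four stub STATEMENTS compose to `Rung n`** (parametric form; sorry-free): the floor's final assembly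
verbatim in dimension `n` — instantiate `M`, `Φ`, `J` by `⟨_, fun _ => rfl⟩`, read `IsSemialgebraic ℚ U` off `r`, and
fill the six fields of `changeOfVariablesRel`. -/
theorem rung_of {n : ℕ}
    (hS : ∀ (A : Fin n → ℚ) (C : ℚ), (∀ i, 0 < A i) → 0 < C →
      ∀ (m : (Fin n → ℝ) → ℝ),
        (∀ p, m p = ∑ i, p i ^ 2 / (A i : ℝ) ^ 2 + (1 - ∑ i, p i ^ 2 / (A i : ℝ)) / (C : ℝ)) →
      ∀ (Φ : (Fin n → ℝ) → Fin n → ℝ), (∀ p i, Φ p i = p i / ((A i : ℝ) * √(m p))) →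
      IsSemialgebraic ℚ {p : Fin n → ℝ | ∑ i, p i ^ 2 / (A i : ℝ) < 1} →
      IsSemialgebraicMapOn ℚ {p : Fin n → ℝ | ∑ i, p i ^ 2 / (A i : ℝ) < 1} Φ)
    (hD : ∀ (a : Fin n → ℝ) (c : ℝ), (∀ i, 0 < a i) → 0 < c →
      ∀ (m : (Fin n → ℝ) → ℝ), (∀ p, m p = ∑ i, p i ^ 2 / a i ^ 2 + (1 - ∑ i, p i ^ 2 / a i) / c) →
      ∀ (Φ : (Fin n → ℝ) → Fin n → ℝ), (∀ p i, Φ p i = p i / (a i * √(m p))) →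
      ∀ (J : (Fin n → ℝ) → Matrix (Fin n) (Fin n) ℝ),
        (∀ p i j, J p i j = (if i = j then 1 / (a i * √(m p)) else 0) -
          p i * (p j / a j ^ 2 - p j / (a j * c)) / (a i * m p * √(m p))) →
      ∀ p, ∑ i, p i ^ 2 / a i < 1 →
        HasFDerivAt Φ (LinearMap.toContinuousLinearMap (Matrix.toLin' (J p))) p)
    (hB : ∀ (a : Fin n → ℝ) (c : ℝ), (∀ i, 0 < a i) → 0 < c →
      ∀ (m : (Fin n → ℝ) → ℝ), (∀ p, m p = ∑ i, p i ^ 2 / a i ^ 2 + (1 - ∑ i, p i ^ 2 / a i) / c) →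
      ∀ (Φ : (Fin n → ℝ) → Fin n → ℝ), (∀ p i, Φ p i = p i / (a i * √(m p))) →
      InjOn Φ {p : Fin n → ℝ | ∑ i, p i ^ 2 / a i < 1} ∧
        Φ '' {p : Fin n → ℝ | ∑ i, p i ^ 2 / a i < 1} = {w : Fin n → ℝ | ∑ i, w i ^ 2 < 1})
    (hI : ∀ (a : Fin n → ℝ) (c : ℝ), (∀ i, 0 < a i) → 0 < c →
      ∀ (m : (Fin n → ℝ) → ℝ), (∀ p, m p = ∑ i, p i ^ 2 / a i ^ 2 + (1 - ∑ i, p i ^ 2 / a i) / c) →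
      ∀ (Φ : (Fin n → ℝ) → Fin n → ℝ), (∀ p i, Φ p i = p i / (a i * √(m p))) →
      ∀ (J : (Fin n → ℝ) → Matrix (Fin n) (Fin n) ℝ),
        (∀ p i j, J p i j = (if i = j then 1 / (a i * √(m p)) else 0) -
          p i * (p j / a j ^ 2 - p j / (a j * c)) / (a i * m p * √(m p))) →
      ∀ p, ∑ i, p i ^ 2 / a i < 1 →
        1 / ((∏ i, a i) * √(c * (1 - ∑ i, p i ^ 2 / a i)) *
            √(∑ i, p i ^ 2 / a i ^ 2 + (1 - ∑ i, p i ^ 2 / a i) / c) ^ (n + 1)) =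
          1 / √(1 - ∑ i, Φ p i ^ 2) * |(LinearMap.toContinuousLinearMap (Matrix.toLin' (J p))).det|) :
    Rung n := by
  intro A C hA hC r r' hrd hri hr'd hr'i
  have ha : ∀ i, (0 : ℝ) < A i := fun i => by exact_mod_cast hA i
  have hc : (0 : ℝ) < C := by exact_mod_cast hC
  obtain ⟨m, hm⟩ : ∃ m : (Fin n → ℝ) → ℝ, ∀ p, m p = ∑ i, p i ^ 2 / (A i : ℝ) ^ 2 +
      (1 - ∑ i, p i ^ 2 / (A i : ℝ)) / (C : ℝ) := ⟨_, fun _ => rfl⟩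
  obtain ⟨Φ, hΦ⟩ : ∃ Φ : (Fin n → ℝ) → Fin n → ℝ, ∀ p i, Φ p i = p i / ((A i : ℝ) * √(m p)) :=
    ⟨fun p i => p i / ((A i : ℝ) * √(m p)), fun _ _ => rfl⟩
  obtain ⟨J, hJ⟩ : ∃ J : (Fin n → ℝ) → Matrix (Fin n) (Fin n) ℝ, ∀ p i j, J p i j =
      (if i = j then 1 / ((A i : ℝ) * √(m p)) else 0) -
        p i * (p j / (A j : ℝ) ^ 2 - p j / ((A j : ℝ) * (C : ℝ))) / ((A i : ℝ) * m p * √(m p)) :=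
    ⟨fun p => Matrix.of fun i j => (if i = j then 1 / ((A i : ℝ) * √(m p)) else 0) -
        p i * (p j / (A j : ℝ) ^ 2 - p j / ((A j : ℝ) * (C : ℝ))) / ((A i : ℝ) * m p * √(m p)),
      fun _ _ _ => rfl⟩
  have hU : IsSemialgebraic ℚ {p : Fin n → ℝ | ∑ i, p i ^ 2 / (A i : ℝ) < 1} :=
    hrd ▸ r.isSemialgebraic_domain
  have hB' := hB (fun i => (A i : ℝ)) C ha hc m hm Φ hΦ
  refine ⟨n, r, r', Φ, fun p => LinearMap.toContinuousLinearMap (Matrix.toLin' (J p)), ?_,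
    fun x hx => ?_, ?_, ?_, fun x hx => ?_, rfl⟩
  · rw [hrd]
    exact hS A C hA hC m hm Φ hΦ hU
  · rw [hrd] at hx
    exact (hD (fun i => (A i : ℝ)) C ha hc m hm Φ hΦ J hJ x hx).hasFDerivWithinAt
  · rw [hrd]
    exact hB'.1
  · rw [hr'd, hrd, hB'.2]
  · have hx' : ∑ i, x i ^ 2 / (A i : ℝ) < 1 := by
      rw [hrd] at hx
      exact hx
    have hΦx : Φ x ∈ r'.domain := by
      rw [hr'd, ← hB'.2]
      exact Set.mem_image_of_mem Φ hx'
    rw [hri hx, hr'i hΦx]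
    exact hI (fun i => (A i : ℝ)) C ha hc m hm Φ hΦ J hJ x hx'

/-- **`EllipsoidGaussKroneckerCoV` from the four stubs** — the registered composition; its type is literally the rung
decl. -/
theorem EllipsoidGaussKroneckerCoV_of : EllipsoidGaussKroneckerCoV := fun _ =>
  rung_of (fun _ _ hA hC _ hm _ hΦ hU => stub_semialgebraic hA hC hm hΦ hU)
    (fun _ _ ha hc _ hm _ hΦ _ hJ _ hp => stub_hasFDerivAt ha hc hm hΦ hJ hp)
    (fun _ _ ha hc _ hm _ hΦ => stub_bijOn ha hc hm hΦ)
    (fun _ _ ha hc _ hm _ hΦ _ hJ _ hp => stub_integrand ha hc hm hΦ hJ hp)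

/-- Sanity: the rung at `n = 2` is implied by (hence, with the witness file, equivalent in provability to) the floor's
shape — `Rung 2` follows from the floor decl (see `Lines/EllipsoidGaussKronecker_special.lean` for the sorry-free
`rung_two`); here only the statement-level link used by the tribunal's `same-rung` reading: the crux-level decl
quantifies over ALL `n`, so `EllipsoidGaussMapCoV → EllipsoidGaussKroneckerCoV` is not cheap (n = 3 is new content). -/
example : EllipsoidGaussKroneckerCoV → Rung 2 := fun h => h 2

end Summit.KontsevichZagierPeriods.KontsevichZagierPeriods.Theses.GaussKroneckerLadder

end
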